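import Summits.BirchSwinnertonDyer.BirchSwinnertonDyer.Theorems.ErratumRoadFiveEulerHalfNotRamSplitSetRoad
import Summits.BirchSwinnertonDyer.BirchSwinnertonDyer.Theorems.ErratumRoadFiveRegCertRung8085y1Split
import HarnessLib

/-!
# Route `ErratumRoadFive`, crux `EulerHalfNotRamNoInertSetAtFive` (item stmt-BirchSwinnertonDyer-19715) — the registered BC5 rung
# `stub_rung_res_8085y1` ON THE SPLIT-SET ROAD: the first rung of crux 19715 closed MODULO THE ROUTE'S ITEMS on a Schneider-free road
# (lead's target T1 for seat -w2)

Cell `bsd-stepL`, seat `bsd-line-er5-p1-w2` (D-0154 width seat -w2 on crux 19715, lead `bsd-line-er5-p1`), `--supports stmt-BirchSwinnertonDyer-19715`.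
THEOREMS ONLY, ONE curve: `E = [0,1,1,−6435,−644416]` = Cremona 8085y1 (`N = 8085 = 3·5·7²·11`, `Δ_min = −3⁵·5·7⁷·11⁵`, `c₄ = 2⁵·7²·197`),
the BC5 rung of crux 19715's line `Lines/birth.lean` (v1 plan g26 = v2b lead g0, text VERBATIM in both). tam3-p2 g4 reached the rung on the
exceptional-zero road from SIX published facts + ONE REGMULT certificate row (`Rung8085y1.stub_rung_res_8085y1_of_publishedFacts`, p581669: a
`p`-adic height computation discharging Schneider's conjecture at the pair). THIS FILE reaches it on the SPLIT-SET ROAD — no `p`-adic height, no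
certificate —: the split-set datum of (8085y1, 5) is `S = {3, 11}` (both multiplicative: `3, 11 ∣ Δ`, `3, 11 ∤ c₄`), `5 ∉ S`, no offending split
prime off `S` (a split multiplicative `ℓ` divides `Δ_min`, so `ℓ ∈ {3, 5, 7, 11}`; `ord₅Δ_min = 1`, `ord₇Δ_min = 7`, neither divisible by `5`),
and the Papikian–Rabinoff half `R = {3}` (`5 ∤ 2`). Hence the rung follows from the line's ROAD STUB `stub_splitSetRoadAtFive` (proved in
`…SplitSetRoad.lean`, this seat) — i.e. from the route items `PublishedInputsFive`, `X11aLowerHalf`, `ShimuraParametrizationDataNonempty`,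
`PastenComponentOrdersInput`, `ShimuraCasselsTateLevelInputs` and the HELD `shimuraCurve_heegnerSystem_primitivesSplitReduced`, BY NAME.

* `Δ_eq`, `mult_three`, `mult_eleven`, `minimalDiscriminantInt_eq`, `eq_of_prime_dvd_Δ`, `not_five_dvd_padicValInt_of_split_of_not_mem` — the
  integer-model facts (pattern of tam3-p2 g4's `Rung8085y1.mult_five`, `IntModel.*` of `Rank1ResidualIntModelReduction`).
* `splitSetDatum` — the split-set datum `S = {3, 11}`, `R = {3}` of (8085y1, 5), in the road stub's shape.
* `stub_rung_res_8085y1_of_items` — the registered rung text VERBATIM as conclusion, hypotheses = the six inputs of the road stub.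

HONEST FRAMING: CONDITIONAL on the items (OPEN: `X11aLowerHalf`; typed-not-proved: `casselsTate_levelInputs`, the HELD split primitives,
`PastenShimura2024_componentOrders`, `nonempty_shimuraParametrizationData`); no definition, no named fact, no `sorry`; the rung is a helper, not a
closure of crux 19715; BSD(8085y1, 5) is NOT proved by this (it would also need the lower half); nothing booked; no summit statement is touched.

References: [Cremona1997] Table 1 (curve 8085y1); [SilvermanAEC2009] VII.5 Prop. 5.1(b); [PastenShimura2024] Lemma 6.18;
[PapikianRabinoff2016] Cor. 3.5; [JetchevSkinnerWan2017] §7.4.2, Thm. 4.4.1.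
-/

noncomputable section

open scoped Classical

open WeierstrassCurve NumberField IsDedekindDomain Literature.NumberTheory.EllipticCurves
  Literature.NumberTheory.EllipticCurves.Rank1Residual
  Literature.NumberTheory.EllipticCurves.Rank1Residual.Typed
  Summit.BirchSwinnertonDyer.Rank1Residual Summit.BirchSwinnertonDyer.Rank1Residual.X11b
  Summit.BirchSwinnertonDyer.BirchSwinnertonDyer.Rank1Residual
  Summit.BirchSwinnertonDyer.BirchSwinnertonDyer.Theses.ErratumRoadFive

-- the cell's Theorems namespace repeats the summit name (Summit.<Summit>.<Problem>), as in every sibling file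
set_option linter.dupNamespace false

namespace Summit.BirchSwinnertonDyer.BirchSwinnertonDyer.Theorems.EulerHalfSplitTwinRoad.Rung8085y1

/-! ### Integer-model facts of 8085y1 -/

/-- `Δ(E₀) = −161148394786995 = −3⁵·5·7⁷·11⁵` on the integer equation. [cite: Cremona1997, Table 1 (curve 8085y1)] -/
theorem Δ_eq : (⟨0, 1, 1, -6435, -644416⟩ : WeierstrassCurve ℤ).Δ = -161148394786995 := by
  norm_num [WeierstrassCurve.Δ, WeierstrassCurve.b₂, WeierstrassCurve.b₄, WeierstrassCurve.b₆, WeierstrassCurve.b₈]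

/-- `c₄(E₀) = 308896 = 2⁵·7²·197` on the integer equation. [cite: Cremona1997, Table 1 (curve 8085y1)] -/
theorem c₄_eq : (⟨0, 1, 1, -6435, -644416⟩ : WeierstrassCurve ℤ).c₄ = 308896 := by
  norm_num [WeierstrassCurve.c₄, WeierstrassCurve.b₂, WeierstrassCurve.b₄]

/-- **`E` is multiplicative at `3`** (`3 ∣ Δ`, `3 ∤ c₄`; Silverman AEC VII.5.1(b)). [cite: SilvermanAEC2009, VII.5 Prop. 5.1(b)] -/
theorem mult_three [Fact (Nat.Prime 3)] [((⟨0, 1, 1, -6435, -644416⟩ : WeierstrassCurve ℤ).baseChange ℚ).IsElliptic]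
    [((⟨0, 1, 1, -6435, -644416⟩ : WeierstrassCurve ℤ).baseChange ℚ).IsGloballyMinimal] :
    Mult ((⟨0, 1, 1, -6435, -644416⟩ : WeierstrassCurve ℤ).baseChange ℚ) 3 :=
  IntModel.hasMultiplicativeReductionAtPrime_of_intModel RegMult.Rung8085y1.integralModelInt_eq 3
    (by rw [Δ_eq]; norm_num) (by rw [c₄_eq]; norm_num)

/-- **`E` is multiplicative at `11`** (`11 ∣ Δ`, `11 ∤ c₄`). [cite: SilvermanAEC2009, VII.5 Prop. 5.1(b)] -/
theorem mult_eleven [Fact (Nat.Prime 11)] [((⟨0, 1, 1, -6435, -644416⟩ : WeierstrassCurve ℤ).baseChange ℚ).IsElliptic]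
    [((⟨0, 1, 1, -6435, -644416⟩ : WeierstrassCurve ℤ).baseChange ℚ).IsGloballyMinimal] :
    Mult ((⟨0, 1, 1, -6435, -644416⟩ : WeierstrassCurve ℤ).baseChange ℚ) 11 :=
  IntModel.hasMultiplicativeReductionAtPrime_of_intModel RegMult.Rung8085y1.integralModelInt_eq 11
    (by rw [Δ_eq]; norm_num) (by rw [c₄_eq]; norm_num)

/-- `Δ_min(E) = −161148394786995`. [cite: Cremona1997, Table 1 (curve 8085y1)] -/
theorem minimalDiscriminantInt_eq [((⟨0, 1, 1, -6435, -644416⟩ : WeierstrassCurve ℤ).baseChange ℚ).IsGloballyMinimal] :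
    ((⟨0, 1, 1, -6435, -644416⟩ : WeierstrassCurve ℤ).baseChange ℚ).minimalDiscriminantInt = -161148394786995 := by
  rw [IntModel.minimalDiscriminantInt_eq RegMult.Rung8085y1.integralModelInt_eq, Δ_eq]

/-- A prime dividing `Δ_min(E) = −3⁵·5·7⁷·11⁵` is one of `3, 5, 7, 11`. [cite: Cremona1997, Table 1 (curve 8085y1)] -/
theorem eq_of_prime_dvd_Δ {ℓ : ℕ} (hℓ : ℓ.Prime) (h : (ℓ : ℤ) ∣ -161148394786995) :
    ℓ = 3 ∨ ℓ = 5 ∨ ℓ = 7 ∨ ℓ = 11 := by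
  have h' : ℓ ∣ 3 ^ 5 * 5 * 7 ^ 7 * 11 ^ 5 := by
    have h1 : (ℓ : ℤ) ∣ ((161148394786995 : ℕ) : ℤ) := by
      rw [← dvd_neg]; exact_mod_cast h
    have h2 : ℓ ∣ 161148394786995 := Int.natCast_dvd_natCast.mp h1
    norm_num
    exact h2
  rcases (Nat.Prime.dvd_mul hℓ).mp h' with h1 | h1
  · rcases (Nat.Prime.dvd_mul hℓ).mp h1 with h2 | h2
    · rcases (Nat.Prime.dvd_mul hℓ).mp h2 with h3 | h3
      · exact Or.inl ((Nat.prime_dvd_prime_iff_eq hℓ Nat.prime_three).mp (hℓ.dvd_of_dvd_pow h3))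
      · exact Or.inr (Or.inl ((Nat.prime_dvd_prime_iff_eq hℓ Nat.prime_five).mp h3))
    · exact Or.inr (Or.inr (Or.inl ((Nat.prime_dvd_prime_iff_eq hℓ (by norm_num)).mp (hℓ.dvd_of_dvd_pow h2))))
  · exact Or.inr (Or.inr (Or.inr ((Nat.prime_dvd_prime_iff_eq hℓ (by norm_num)).mp (hℓ.dvd_of_dvd_pow h1))))

/-- **No offending split prime off `S = {3, 11}` at `p = 5`**: a split multiplicative `ℓ ∉ {3, 11}` of `E` divides `Δ_min`, so `ℓ ∈ {5, 7}`,
where `ord₅Δ_min = 1` and `ord₇Δ_min = 7` are prime to `5` (`7` is in fact additive and `5` has `c₅ = 1`; only the valuations are used).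
[cite: Cremona1997, Table 1 (curve 8085y1)] [cite: SilvermanAEC2009, VII.5 Prop. 5.1(b)] -/
theorem not_five_dvd_padicValInt_of_split_of_not_mem [Fact (Nat.Prime 5)]
    [((⟨0, 1, 1, -6435, -644416⟩ : WeierstrassCurve ℤ).baseChange ℚ).IsElliptic]
    [((⟨0, 1, 1, -6435, -644416⟩ : WeierstrassCurve ℤ).baseChange ℚ).IsGloballyMinimal] :
    ∀ (ℓ : ℕ) [Fact ℓ.Prime], ℓ ∉ ({3, 11} : Finset ℕ) →
      ((⟨0, 1, 1, -6435, -644416⟩ : WeierstrassCurve ℤ).baseChange ℚ).HasSplitMultiplicativeReductionAtPrime ℓ →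
      ¬ 5 ∣ padicValInt ℓ ((⟨0, 1, 1, -6435, -644416⟩ : WeierstrassCurve ℤ).baseChange ℚ).minimalDiscriminantInt := by
  intro ℓ hℓF hℓS hs
  have hm := hs.hasMultiplicativeReductionAtPrime
  have hpos := padicValInt_minimalDiscriminantInt_pos_of_mult ((⟨0, 1, 1, -6435, -644416⟩ : WeierstrassCurve ℤ).baseChange ℚ) ℓ hm
  have hdvd : (ℓ : ℤ) ∣ ((⟨0, 1, 1, -6435, -644416⟩ : WeierstrassCurve ℤ).baseChange ℚ).minimalDiscriminantInt := by
    have := (padicValInt_dvd_iff 1 _).mpr (Or.inr hpos)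
    simpa using this
  rw [minimalDiscriminantInt_eq] at hdvd ⊢
  rcases eq_of_prime_dvd_Δ hℓF.out hdvd with rfl | rfl | rfl | rfl
  · simp at hℓS
  · rw [IntModel.padicValInt_eq_of_dvd_of_not_dvd 5 (e := 1) (by norm_num) (by norm_num)]
    decide
  · rw [IntModel.padicValInt_eq_of_dvd_of_not_dvd 7 (e := 7) (by norm_num) (by norm_num)]
    decide
  · simp at hℓS

/-! ### The split-set datum of (8085y1, 5) and the rung -/

/-- **The split-set datum of (8085y1, 5): `S = {3, 11}`, `R = {3}`** (both `S`-primes multiplicative; `#S = 2`; `5 ∉ S`; no offending split prime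
off `S`; Papikian–Rabinoff half `R = {3}` with `5 ∤ 3 − 1`), in the shape of the line's road stub `stub_splitSetRoadAtFive`.
[cite: PastenShimura2024, Lemma 6.18] [cite: PapikianRabinoff2016, Cor. 3.5] [cite: Cremona1997, Table 1 (curve 8085y1)] -/
theorem splitSetDatum [Fact (Nat.Prime 5)]
    [((⟨0, 1, 1, -6435, -644416⟩ : WeierstrassCurve ℤ).baseChange ℚ).IsElliptic]
    [((⟨0, 1, 1, -6435, -644416⟩ : WeierstrassCurve ℤ).baseChange ℚ).IsGloballyMinimal] :
    ∃ S : Finset ℕ, (∀ ℓ ∈ S, ∃ _ : Fact ℓ.Prime, Mult ((⟨0, 1, 1, -6435, -644416⟩ : WeierstrassCurve ℤ).baseChange ℚ) ℓ) ∧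
      Even S.card ∧ 5 ∉ S ∧
      (∀ (ℓ : ℕ) [Fact ℓ.Prime], ℓ ∉ S →
        ((⟨0, 1, 1, -6435, -644416⟩ : WeierstrassCurve ℤ).baseChange ℚ).HasSplitMultiplicativeReductionAtPrime ℓ →
        ¬ 5 ∣ padicValInt ℓ ((⟨0, 1, 1, -6435, -644416⟩ : WeierstrassCurve ℤ).baseChange ℚ).minimalDiscriminantInt) ∧
      ((∃ (ℓ₀ : ℕ) (_ : Fact ℓ₀.Prime), Mult ((⟨0, 1, 1, -6435, -644416⟩ : WeierstrassCurve ℤ).baseChange ℚ) ℓ₀ ∧ ℓ₀ ≠ 5 ∧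
          ¬ 5 ∣ padicValInt ℓ₀ ((⟨0, 1, 1, -6435, -644416⟩ : WeierstrassCurve ℤ).baseChange ℚ).minimalDiscriminantInt) ∨
        ∃ R ⊆ S, S.card = 2 * R.card ∧ ∀ q ∈ R, ¬ 5 ∣ q - 1) := by
  refine ⟨{3, 11}, ?_, by decide, by decide, not_five_dvd_padicValInt_of_split_of_not_mem, Or.inr ⟨{3}, by decide, by decide, ?_⟩⟩
  · intro ℓ hℓ
    simp only [Finset.mem_insert, Finset.mem_singleton] at hℓ
    rcases hℓ with rfl | rfl
    · exact ⟨⟨Nat.prime_three⟩, mult_three⟩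
    · exact ⟨⟨by norm_num⟩, mult_eleven⟩
  · intro q hq
    rw [Finset.mem_singleton] at hq
    subst hq
    decide

/-- **The registered BC5 rung `stub_rung_res_8085y1` of crux 19715 — its text VERBATIM as conclusion — ON THE SPLIT-SET ROAD, modulo the
route's items**: the road stub `stub_splitSetRoadAtFive` (proved, `…SplitSetRoad.lean`) at the split-set datum `S = {3, 11}`, `R = {3}` of
(8085y1, 5). Hypotheses = the six inputs of the road stub (`PublishedInputsFive`, `X11aLowerHalf`, `ShimuraParametrizationDataNonempty`,
`PastenComponentOrdersInput`, `ShimuraCasselsTateLevelInputs`, `shimuraCurve_heegnerSystem_primitivesSplitReduced`); the rung's own binders `Surj`,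
`5 ∣ ∏c`, «∃ multiplicative ℓ ≠ 5», «no inert-set datum» are not used. No `p`-adic height, no certificate row. CONDITIONAL on the items; helper
(the registered rung has no item binders); nothing booked; BSD(8085y1, 5) is NOT proved by this.
[cite: Cremona1997, Table 1 (curve 8085y1)] [cite: JetchevSkinnerWan2017, §7.4.2, Thm. 4.4.1] [cite: PastenShimura2024, Lemma 6.18] -/
theorem stub_rung_res_8085y1_of_items (h₅ : PublishedInputsFive) (h₃ : X11aLowerHalf)
    (hJL : ShimuraParametrizationDataNonempty) (hCO : PastenComponentOrdersInput)
    (hCTi : ShimuraCasselsTateLevelInputs) (hLabS : shimuraCurve_heegnerSystem_primitivesSplitReduced)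
    [((⟨0, 1, 1, -6435, -644416⟩ : WeierstrassCurve ℤ).baseChange ℚ).IsElliptic] [((⟨0, 1, 1, -6435, -644416⟩ : WeierstrassCurve ℤ).baseChange ℚ).IsGloballyMinimal] [Fact (Nat.Prime 5)] :
    Summit.BirchSwinnertonDyer.Rank1Residual.ClassX11b ((⟨0, 1, 1, -6435, -644416⟩ : WeierstrassCurve ℤ).baseChange ℚ) 5 → 5 ≤ 5 → Literature.NumberTheory.EllipticCurves.Rank1Residual.Surj ((⟨0, 1, 1, -6435, -644416⟩ : WeierstrassCurve ℤ).baseChange ℚ) 5 → ¬ Literature.NumberTheory.EllipticCurves.Rank1Residual.Ram ((⟨0, 1, 1, -6435, -644416⟩ : WeierstrassCurve ℤ).baseChange ℚ) 5 → 5 ∣ ((⟨0, 1, 1, -6435, -644416⟩ : WeierstrassCurve ℤ).baseChange ℚ).tamagawaProduct → (∃ ℓ : ℕ, ∃ _ : Fact ℓ.Prime, ℓ ≠ 5 ∧ ((⟨0, 1, 1, -6435, -644416⟩ : WeierstrassCurve ℤ).baseChange ℚ).HasMultiplicativeReductionAtPrime ℓ) → ¬ (∃ S : Finset ℕ, (∀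 ℓ ∈ S, ∃ _ : Fact ℓ.Prime, Literature.NumberTheory.EllipticCurves.Rank1Residual.Mult ((⟨0, 1, 1, -6435, -644416⟩ : WeierstrassCurve ℤ).baseChange ℚ) ℓ) ∧ Even S.card ∧ 5 ∈ S ∧ (∀ (ℓ : ℕ) [Fact ℓ.Prime], ℓ ∉ S → ((⟨0, 1, 1, -6435, -644416⟩ : WeierstrassCurve ℤ).baseChange ℚ).HasSplitMultiplicativeReductionAtPrime ℓ → ¬ 5 ∣ padicValInt ℓ ((⟨0, 1, 1, -6435, -644416⟩ : WeierstrassCurve ℤ).baseChange ℚ).minimalDiscriminantInt) ∧ (¬ 5 ∣ padicValInt 5 ((⟨0, 1, 1, -6435, -644416⟩ : WeierstrassCurve ℤ).baseChange ℚ).minimalDiscriminantInt ∨ ∃ R ⊆ S, S.card = 2 * R.card ∧ ∀ q ∈ R, q ≠ 2 ∧ ¬ 5 ∣ q - 1)) → Literature.NumberTheory.EllipticCurves.Rank1Residual.Typed.MissingUpperBoundAt ((⟨0, 1, 1, -6435, -644416⟩ : WeierstrassCurve ℤ).baseChange ℚ) 5 := by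
  intro hX hp5 _ hnram _ _ _
  exact stub_splitSetRoadAtFive h₅ h₃ hJL hCO hCTi hLabS _ 5 hX hp5 hnram splitSetDatum

end Summit.BirchSwinnertonDyer.BirchSwinnertonDyer.Theorems.EulerHalfSplitTwinRoad.Rung8085y1

end
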